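import Mathlib
import Literature.Computability.Complexity.Classes
import Literature.Computability.Complexity.Nondeterministic
import Literature.Computability.Complexity.Space
import Literature.Computability.Complexity.DecisionTree
import Literature.Computability.Complexity.ConstantDepth
import Literature.Computability.Complexity.UniformCircuitClasses
import Literature.Computability.MetaComplexity.ChenJinSanthanamWilliams2022.MCSPRefuterMagnification

/-!
# Chen–Jin–Santhanam–Williams (FOCS 2021), Theorem 1.6: uniform-`AC⁰` / `NC¹` REFUTERS for the
# coin problem `GapMAJ_{n,ε}` against `o(1/ε²)`-query randomized algorithms magnify to `P ≠ NP` /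
# `P ≠ PSPACE` (magnification-gap census row R37)

Topic `Literature/Computability/MetaComplexity`, directory `ChenJinSanthanamWilliams2022/`
(bib key `ChenEtAl2022`: L. Chen, C. Jin, R. Santhanam, R. Williams, *Constructive separations
and their consequences*, FOCS 2021 (IEEE 2022) pp. 646–657 = arXiv:2203.14379 = TheoretiCS 3
(2024)).  Companion of `MCSPRefuterMagnification.lean` (Thm. 1.7, census row R38), whose
uniform-`AC⁰` printing families `IsUniformAC0Family` / `printed` (D9, address form) are reused.
Locators are chunk:line of the held LaTeX-source text `paper:arxiv-2203.14379`.

## The printed statements (verbatim)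

* The problem (p0005 L31–33): "Consider the following basic problem `GapMAJ_{n,ε}` for a
  parameter `ε < 1/2`.  `GapMAJ_{n,ε}`: Given an input `x ∈ {0,1}ⁿ`, letting
  `p = (1/n) Σ_{i=1}^n x_i`, distinguish between the cases `p < 1/2 − ε` or `p > 1/2 + ε`."
* The known, non-constructive lower bound (p0006 L1, K side of the census row, NOT typed here):
  "It is well-known that every randomized query algorithm needs `Θ(1/ε²)` queries to solve
  `GapMAJ_{n,ε}` with constant success probability (uniform random sampling is the best one can
  do). That is, any randomized query algorithm making `o(1/ε²)` queries must make mistakes on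
  some inputs, with high probability." [BrodyV10]
* Thm. 1.6 (p0006 L3–7): "Let `ε` be a function of `n` satisfying `ε ≤ 1/(log n)^{ω(1)}`, and
  `1/ε` is a positive integer computable in `poly(1/ε)` time given `n` in binary.
  • If there is a polylogtime-uniform-`AC⁰`-constructive separation of `GapMAJ_{n,ε}` from
    randomized query algorithms `A` using `o(1/ε²)` queries and `poly(1/ε)` time, then `NP ≠ P`.
  • If there is a polylogtime-uniform-`NC¹`-constructive separation of `GapMAJ_{n,ε}` from
    randomized query algorithms `A` using `o(1/ε²)` queries and `poly(1/ε)` time, then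
    `PSPACE ≠ P`."
* Refuters and constructive separations (Def. 1.1, p0003 L19–40): a refuter for `f` against `A`
  "given input `1ⁿ`, prints a string `x ∈ {0,1}ⁿ`, such that for infinitely many `n`,
  `A(x) ≠ f(x)`"; "there is a `𝒟`-constructive separation of `f ∉ 𝒞`, if for every algorithm
  `A` computable in `𝒞`, there is a refuter for `f` against `A` that is computable in `𝒟`.
  Note that we allow the refuter algorithm to depend on the algorithm `A`. […] we only consider
  randomized algorithms `A` with bounded probability gap, that is, on every input `x` there is
  an answer `b ∈ {0,1}` such that `A` outputs `b` with at least `2/3` probability, and we denote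
  this answer `b` by `A(x)`."  Uniform-circuit refuters (p0005 L21): "polylogtime-uniform-`AC⁰`
  circuits that output counterexamples […] on infinitely many input lengths."

## Rendering notes (F-rules: typed HYPOTHESIS ⇒ printed hypothesis, so printed theorem ⇒ typed)

(i) THE REFUTED ALGORITHMS.  A randomized query algorithm is presented EXTENSIONALLY, length by
length, as a probability distribution over deterministic decision trees on `n` bits — the
tree's randomized decision trees (`Complexity.DecisionTree`, `PMF (DecisionTree n)`, exactly the
objects of `randQueryComplexityOn`).  "`A` uses `q(n)` queries" = every tree in the support has
depth `≤ q n`; "bounded probability gap" as printed; the printed `poly(1/ε)` TIME bound and the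
uniformity of `A` are DROPPED.  Every printed algorithm (a uniform randomized machine making
`≤ q(n)` adaptive queries within its time bound, hence with finitely many coin sequences) induces
such a family, so the typed class `SubquadraticQueryAlgs e` CONTAINS the printed class: a typed
constructive separation (a refuter against every member of the larger class) is in particular a
printed one.
(ii) `ε = 1/e(n)` with `e : ℕ → ℕ`, `e n ≥ 1` ("`1/ε` is a positive integer").  "`ε ≤
1/(log n)^{ω(1)}`" = `IsSuperpolylog e` (for every `c`, eventually `(⌊log₂ n⌋)^c ≤ e n`).
"computable in `poly(1/ε)` time given `n` in binary" is typed STRONGER as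
`PolyTimeComputable encodeNat encodeNat e` (time polynomial in `|bin n| = O(log n)`, which is
`≤ poly(e(n))` eventually because `e n ≥ log₂ n` eventually).  In integers, `p > 1/2 + ε` reads
`e·n + 2n < 2e·w` and `p < 1/2 − ε` reads `2e·w + 2n < e·n`, `w` = Hamming weight (the tree's
`GateFn.numOnes`).
(iii) THE REFUTER is a uniform circuit family in the ADDRESS FORM of D9 (`printed C k ∈
{0,1}^{2^k}`, `IsUniformAC0Family`: `P`-DCL-uniform constant-depth `acBasis` families; see the
rendering notes (i)–(ii) of `MCSPRefuterMagnification.lean` for the conversion to and from the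
printed multi-output polylogtime-uniform circuits, which is size-polynomial and depth `+O(1)`),
of size `poly(N)` (`polyBoundAt c k = 2^{c k + c} = 2^c · N^c`), succeeding at infinitely many
lengths of the form `N = 2^k` — a special case of "infinitely many `n`".  "`A(x) ≠
GapMAJ_{n,ε}(x)`" for the PROMISE problem is typed as: `x` satisfies the promise and `A`
outputs the correct answer with probability `< 2/3` (for a bounded-gap `A` this says exactly that
its `2/3`-answer `A(x)` is wrong; a reading in which non-promise inputs may also count as
counterexamples only weakens the printed refuter notion, so typed ⇒ printed either way).  The
`NC¹` refuters of item 2 are typed likewise over the bounded fan-in basis `B2` with depth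
`O(k) = O(log N)` (`IsUniformNC1Family`, mirroring the tree's non-uniform `NC 1`).
(iv) NOT TYPED: the K side (the `Ω(1/ε²)` sampling lower bound is quoted above as printed; its
range of validity in `n` versus `ε` is not stated in print and is not asserted here), the
`P^NP` / streaming statements Thm. 1.3–1.5, and Thm. 1.6's proof ingredients (Lemma
(lem:pnpac0), PAC-learning of small circuits under `P = NP`).
(v) PROVED here (non-vacuity and calibration of the typed hypothesis): the class is inhabited
(`constAlg_mem`); the refuter CONDITION is met against the constant-`0` algorithm by any family
printing all-ones strings (`isGapMajRefuterAgainst_constAlg_false`); NO refuter exists against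
the exact majority algorithm (`not_isGapMajRefuterAgainst_exactAlg`), which makes `n` queries —
so the typed (and the printed) hypothesis is unsatisfiable as soon as `n = o(e(n)²)`, i.e. for
`ε = o(n^{-1/2})` (`not_hypothesis_of_isLittleO`): the live regime of Thm. 1.6 is
`n^{-1/2} ≲ ε ≤ (log n)^{-ω(1)}`.
-/

namespace Literature.Computability.MetaComplexity.ChenJinSanthanamWilliams2022

open _root_.Computability Filter Asymptotics
open Literature.Computability.Complexity Literature.Computability.MetaComplexity

variable {n : ℕ}

/-! ### The coin problem `GapMAJ_{n,ε}`, `ε = 1/e` -/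

/-- The all-ones input has Hamming weight `n` (weight = the tree's `GateFn.numOnes`). [folklore] -/
@[simp] theorem numOnes_const_true : GateFn.numOnes (fun _ : Fin n => true) = n := by
  simp [GateFn.numOnes]

/-- The all-zeros input has Hamming weight `0`. [folklore] -/
@[simp] theorem numOnes_const_false : GateFn.numOnes (fun _ : Fin n => false) = 0 := by
  simp [GateFn.numOnes]

/-- YES instances of `GapMAJ_{n,ε}`, `ε = 1/e`: `p > 1/2 + ε`, i.e. `e·n + 2n < 2e·w(x)`
(rendering note (ii)). [cite: ChenEtAl2022, §1.2.2 (GapMAJ, p.5)] -/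
def GapMajYes (e : ℕ) (x : Fin n → Bool) : Prop := e * n + 2 * n < 2 * e * GateFn.numOnes x

/-- NO instances of `GapMAJ_{n,ε}`, `ε = 1/e`: `p < 1/2 − ε`, i.e. `2e·w(x) + 2n < e·n`
(rendering note (ii)). [cite: ChenEtAl2022, §1.2.2 (GapMAJ, p.5)] -/
def GapMajNo (e : ℕ) (x : Fin n → Bool) : Prop := 2 * e * GateFn.numOnes x + 2 * n < e * n

/-- The YES predicate is decidable (an inequality of naturals). [folklore] -/
instance instDecidableGapMajYes (e : ℕ) (x : Fin n → Bool) : Decidable (GapMajYes e x) := by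
  unfold GapMajYes; infer_instance

/-- The NO predicate is decidable. [folklore] -/
instance instDecidableGapMajNo (e : ℕ) (x : Fin n → Bool) : Decidable (GapMajNo e x) := by
  unfold GapMajNo; infer_instance

/-- The promise of `GapMAJ_{n,ε}`: "distinguish between the cases `p < 1/2 − ε` or
`p > 1/2 + ε`". [cite: ChenEtAl2022, §1.2.2 (GapMAJ, p.5)] -/
def gapMajDomain (n e : ℕ) : Set (Fin n → Bool) := {x | GapMajYes e x ∨ GapMajNo e x}

/-- The correct answer on the promise: `1` on YES instances, `0` on NO instances (off the
promise the value is immaterial). [cite: ChenEtAl2022, §1.2.2 (GapMAJ, p.5)] -/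
def gapMajAnswer (e : ℕ) (x : Fin n → Bool) : Bool := decide (GapMajYes e x)

/-- The two cases of the promise are disjoint. [folklore] -/
theorem not_gapMajYes_of_gapMajNo {e : ℕ} {x : Fin n → Bool} (h : GapMajNo e x) :
    ¬ GapMajYes e x := by
  unfold GapMajYes; unfold GapMajNo at h; omega

/-- The all-ones input is a YES instance as soon as `ε < 1/2` (`e ≥ 3`) and `n ≥ 1`. [folklore] -/
theorem gapMajYes_const_true {e : ℕ} (he : 3 ≤ e) (hn : 1 ≤ n) :
    GapMajYes e (fun _ : Fin n => true) := by
  unfold GapMajYes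
  rw [numOnes_const_true]
  nlinarith

/-- The all-zeros input is a NO instance as soon as `e ≥ 3` and `n ≥ 1`. [folklore] -/
theorem gapMajNo_const_false {e : ℕ} (he : 3 ≤ e) (hn : 1 ≤ n) :
    GapMajNo e (fun _ : Fin n => false) := by
  unfold GapMajNo
  rw [numOnes_const_false]
  nlinarith

/-! ### Randomized query algorithms, extensionally (rendering note (i)) -/

/-- **A randomized query algorithm**, presented extensionally: at every input length `n`, a
probability distribution over deterministic decision trees on `n` bits (the tree's randomized
decision trees, `DecisionTree.lean`). [cite: ChenEtAl2022, Thm. 1.6 (randomized query algorithms)] -/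
abbrev RandQueryAlg : Type := (n : ℕ) → PMF (DecisionTree n)

namespace RandQueryAlg

/-- The probability that `A` outputs `b` on input `x`. [cite: ChenEtAl2022, Def. 1.1 (bounded probability gap)] -/
noncomputable def outputPr (A : RandQueryAlg) (x : Fin n → Bool) (b : Bool) : ℝ :=
  ((A n).toOuterMeasure {T | T.eval x = b}).toReal

/-- **Bounded probability gap** (Def. 1.1 convention): "on every input `x` there is an answer
`b ∈ {0,1}` such that `A` outputs `b` with at least `2/3` probability".
[cite: ChenEtAl2022, Def. 1.1 (bounded probability gap)] -/
def IsGapped (A : RandQueryAlg) : Prop :=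
  ∀ (n : ℕ) (x : Fin n → Bool), ∃ b : Bool, (2 : ℝ) / 3 ≤ A.outputPr x b

/-- "`A` uses at most `q(n)` queries": every decision tree in the support at length `n` has
depth `≤ q n`. [cite: ChenEtAl2022, Thm. 1.6 (query bound)] -/
def QueriesLe (A : RandQueryAlg) (q : ℕ → ℕ) : Prop :=
  ∀ n, ∀ T ∈ (A n).support, T.depth ≤ q n

/-- **`A` fails on `x` for `GapMAJ_{n,1/e(n)}`** (rendering note (iii)): `x` satisfies the promise
and `A` outputs the correct answer with probability `< 2/3` (for bounded-gap `A`: its answer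
`A(x)` differs from `GapMAJ_{n,ε}(x)`). [cite: ChenEtAl2022, Def. 1.1 (A(x) ≠ f(x))] -/
def FailsOn (A : RandQueryAlg) (e : ℕ → ℕ) (x : Fin n → Bool) : Prop :=
  x ∈ gapMajDomain n (e n) ∧ A.outputPr x (gapMajAnswer (e n) x) < 2 / 3

end RandQueryAlg

/-- **The refuted class of Thm. 1.6**: bounded-gap randomized query algorithms using `o(1/ε²) =
o(e(n)²)` queries (the printed `poly(1/ε)` time bound is dropped: a superset of the printed class,
rendering note (i)). [cite: ChenEtAl2022, Thm. 1.6 (randomized query algorithms using o(1/ε²) queries)] -/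
def SubquadraticQueryAlgs (e : ℕ → ℕ) : Set RandQueryAlg :=
  {A | A.IsGapped ∧ ∃ q : ℕ → ℕ, A.QueriesLe q ∧
    (fun n => (q n : ℝ)) =o[atTop] fun n => (e n : ℝ) ^ 2}

/-! ### Uniform-circuit refuters for `GapMAJ` (address form, rendering note (iii)) -/

/-- A printed string read as an input to a query algorithm of the same length. [folklore] -/
def asInput (l : List Bool) : Fin l.length → Bool := fun i => l.get i

/-- **`C` refutes `A` on `GapMAJ_{·,1/e}`**: for infinitely many `k`, the printed `2^k`-bit string
`printed C k` is a promise input of `GapMAJ_{2^k, 1/e(2^k)}` on which `A` fails ("output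
counterexamples […] on infinitely many input lengths", lengths `N = 2^k`).
[cite: ChenEtAl2022, §1.2.2 (uniform-AC⁰ refuters, p.5) and Def. 1.1] -/
def IsGapMajRefuterAgainst (e : ℕ → ℕ) (A : RandQueryAlg) (C : CircuitFamily) : Prop :=
  ∃ᶠ k in atTop, A.FailsOn e (asInput (printed C k))

/-- Polynomial size at `N = 2^k` in address form: `2^{c k + c} = 2^c · N^c`. [folklore] -/
def polyBoundAt (c k : ℕ) : ℕ := 2 ^ (c * k + c)

/-- **There is a polylogtime-uniform `AC⁰` refuter for `GapMAJ_{·,1/e}` against `A`** (D9's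
`IsUniformAC0Family` of polynomial size). [cite: ChenEtAl2022, Thm. 1.6 item 1 (hypothesis)] -/
def HasGapMajAC0Refuter (e : ℕ → ℕ) (A : RandQueryAlg) : Prop :=
  ∃ c : ℕ, ∃ C : CircuitFamily, IsUniformAC0Family (polyBoundAt c) C ∧ IsGapMajRefuterAgainst e A C

/-- **A polylogtime-uniform `NC¹` circuit family of size `≤ S`, address form**: `C k` is over the
bounded fan-in basis `B2`, of depth `≤ c·k + c = O(log N)` at `N = 2^k`, size `≤ S k`, and the
family is `P`-DCL-uniform (as in `IsUniformAC0Family`; mirrors the tree's non-uniform `NC 1`).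
[cite: ChenEtAl2022, Thm. 1.6 item 2 (polylogtime-uniform NC¹)] -/
def IsUniformNC1Family (S : ℕ → ℕ) (C : CircuitFamily) : Prop :=
  (∃ c : ℕ, ∀ k, (C k).IsOver B2 ∧ (C k).acDepth ≤ c * k + c ∧ (C k).size ≤ S k) ∧
    C.IsDCUniform Classes.P

/-- **There is a polylogtime-uniform `NC¹` refuter for `GapMAJ_{·,1/e}` against `A`.**
[cite: ChenEtAl2022, Thm. 1.6 item 2 (hypothesis)] -/
def HasGapMajNC1Refuter (e : ℕ → ℕ) (A : RandQueryAlg) : Prop :=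
  ∃ c : ℕ, ∃ C : CircuitFamily, IsUniformNC1Family (polyBoundAt c) C ∧ IsGapMajRefuterAgainst e A C

/-! ### The admissible gap parameters (rendering note (ii)) -/

/-- `ε ≤ 1/(log n)^{ω(1)}`: for every `c`, eventually `(⌊log₂ n⌋)^c ≤ e n = 1/ε`.
[cite: ChenEtAl2022, Thm. 1.6 (hypothesis on ε)] -/
def IsSuperpolylog (e : ℕ → ℕ) : Prop :=
  ∀ c : ℕ, ∀ᶠ n in atTop, Nat.log 2 n ^ c ≤ e n

/-- **Admissible `ε = 1/e`** for Thm. 1.6: `ε ≤ 1/(log n)^{ω(1)}`; "`1/ε` is a positive integer";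
"computable in `poly(1/ε)` time given `n` in binary", typed stronger as polynomial time in the
binary length of `n`. [cite: ChenEtAl2022, Thm. 1.6 (hypothesis on ε)] -/
def IsAdmissibleGap (e : ℕ → ℕ) : Prop :=
  IsSuperpolylog e ∧ (∀ n, 1 ≤ e n) ∧ PolyTimeComputable encodeNat encodeNat e

/-! ### The named facts (T side of census row R37) -/

/-- **[CJSW21, Thm. 1.6 item 1].**  For admissible `ε = 1/e`: if every bounded-gap randomized
query algorithm using `o(1/ε²)` queries admits a polynomial-size polylogtime-uniform `AC⁰` family
printing, for infinitely many `N = 2^k`, a promise input of `GapMAJ_{N,ε}` on which it fails, then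
`P ≠ NP`.  Printed (p0006 L5): "If there is a polylogtime-uniform-`AC⁰`-constructive separation of
`GapMAJ_{n,ε}` from randomized query algorithms `A` using `o(1/ε²)` queries and `poly(1/ε)` time,
then `NP ≠ P`."  Typed hypothesis ⇒ printed hypothesis: rendering notes (i)–(iii).
[cite: ChenEtAl2022, Thm. 1.6 item 1] -/
def thm16_item1 : Prop :=
  ∀ e : ℕ → ℕ, IsAdmissibleGap e →
    (∀ A ∈ SubquadraticQueryAlgs e, HasGapMajAC0Refuter e A) → Classes.P ≠ Nondeterministic.NP

/-- **[CJSW21, Thm. 1.6 item 2].**  Same with polylogtime-uniform `NC¹` refuters and the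
conclusion `P ≠ PSPACE`.  Printed (p0006 L7): "If there is a polylogtime-uniform-`NC¹`-constructive
separation of `GapMAJ_{n,ε}` from randomized query algorithms `A` using `o(1/ε²)` queries and
`poly(1/ε)` time, then `PSPACE ≠ P`." [cite: ChenEtAl2022, Thm. 1.6 item 2] -/
def thm16_item2 : Prop :=
  ∀ e : ℕ → ℕ, IsAdmissibleGap e →
    (∀ A ∈ SubquadraticQueryAlgs e, HasGapMajNC1Refuter e A) → Classes.P ≠ PSPACE

/-! ### Proved: the typed class and refuter condition are inhabited (rendering note (v)) -/

/-- The constant algorithm answering `b` without queries. [folklore] -/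
noncomputable def constAlg (b : Bool) : RandQueryAlg := fun n => PMF.pure (DecisionTree.leaf (n := n) b)

/-- Output probabilities of a deterministic (Dirac) algorithm. [folklore] -/
theorem outputPr_pure (T : (n : ℕ) → DecisionTree n) (x : Fin n → Bool) (b : Bool) :
    RandQueryAlg.outputPr (fun n => PMF.pure (T n)) x b = if (T n).eval x = b then 1 else 0 := by
  unfold RandQueryAlg.outputPr
  rw [PMF.toOuterMeasure_pure_apply]
  by_cases h : (T n).eval x = b
  · simp [h]
  · simp [h]

/-- The constant algorithm outputs `b` with probability `1` and `¬b` with probability `0`. [folklore] -/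
theorem outputPr_constAlg (b : Bool) (x : Fin n → Bool) (b' : Bool) :
    (constAlg b).outputPr x b' = if b = b' then 1 else 0 := by
  unfold constAlg
  rw [outputPr_pure]
  simp [DecisionTree.eval]

/-- The constant algorithm has a bounded gap. [folklore] -/
theorem constAlg_isGapped (b : Bool) : (constAlg b).IsGapped := by
  intro n x
  refine ⟨b, ?_⟩
  rw [outputPr_constAlg]
  simp only [if_true]
  norm_num

/-- The constant algorithm makes no queries. [folklore] -/
theorem constAlg_queriesLe (b : Bool) : (constAlg b).QueriesLe fun _ => 0 := by
  intro n T hT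
  unfold constAlg at hT
  rw [PMF.mem_support_pure_iff] at hT
  subst hT
  simp [DecisionTree.depth]

/-- **The refuted class is inhabited** (for every `e`): the constant algorithms use `0 = o(e²)`
queries. [folklore] -/
theorem constAlg_mem (b : Bool) (e : ℕ → ℕ) : constAlg b ∈ SubquadraticQueryAlgs e := by
  refine ⟨constAlg_isGapped b, fun _ => 0, constAlg_queriesLe b, ?_⟩
  simp

/-- The constant-`0` algorithm fails on the all-ones input of any length `n ≥ 1` once `ε < 1/2`
(`e n ≥ 3`). [folklore] -/
theorem failsOn_constAlg_false {e : ℕ → ℕ} (he : 3 ≤ e n) (hn : 1 ≤ n) :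
    (constAlg false).FailsOn e (fun _ : Fin n => true) := by
  have hyes : GapMajYes (e n) (fun _ : Fin n => true) := gapMajYes_const_true he hn
  refine ⟨Or.inl hyes, ?_⟩
  have hans : gapMajAnswer (e n) (fun _ : Fin n => true) = true := by
    simp [gapMajAnswer, hyes]
  rw [hans, outputPr_constAlg]
  norm_num

/-- A printed string all of whose letters are `1` reads as the all-ones input. [folklore] -/
theorem asInput_eq_const_true {l : List Bool} (h : ∀ i : Fin l.length, l.get i = true) :
    asInput l = fun _ => true := by
  funext i; exact h i

/-- **The refuter condition is met** against the constant-`0` algorithm by ANY family that, for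
all large `k`, prints an all-ones string (and `ε(2^k) < 1/2`); uniformity of such a family (one
`∧₀` gate) is standard and not constructed here. [folklore] -/
theorem isGapMajRefuterAgainst_constAlg_false {e : ℕ → ℕ} {C : CircuitFamily}
    (h : ∀ᶠ k in atTop, 3 ≤ e (printed C k).length ∧ ∀ i : Fin (printed C k).length,
      (printed C k).get i = true) :
    IsGapMajRefuterAgainst e (constAlg false) C := by
  refine Filter.Eventually.frequently (h.mono fun k hk => ?_)
  obtain ⟨he, hall⟩ := hk
  rw [asInput_eq_const_true hall]
  refine failsOn_constAlg_false he ?_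
  rw [length_printed]
  exact Nat.one_le_two_pow

/-! ### Proved: calibration — no refuter against the exact algorithm (rendering note (v)) -/

/-- The exact algorithm: at each length, a deterministic decision tree (of depth `≤ n`) computing
the correct `GapMAJ_{n,1/e(n)}` answer everywhere (`DecisionTree.exists_computes_depth_le`). [folklore] -/
noncomputable def exactTree (e : ℕ → ℕ) (n : ℕ) : DecisionTree n :=
  Classical.choose (DecisionTree.exists_computes_depth_le (gapMajAnswer (n := n) (e n)))

/-- The exact tree computes the answer. [folklore] -/
theorem exactTree_computes (e : ℕ → ℕ) (n : ℕ) :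
    (exactTree e n).Computes (gapMajAnswer (e n)) :=
  (Classical.choose_spec (DecisionTree.exists_computes_depth_le (gapMajAnswer (n := n) (e n)))).1

/-- The exact tree has depth `≤ n`. [folklore] -/
theorem exactTree_depth_le (e : ℕ → ℕ) (n : ℕ) : (exactTree e n).depth ≤ n :=
  (Classical.choose_spec (DecisionTree.exists_computes_depth_le (gapMajAnswer (n := n) (e n)))).2

/-- The exact (deterministic, `n`-query) algorithm for `GapMAJ_{·,1/e}`. [folklore] -/
noncomputable def exactAlg (e : ℕ → ℕ) : RandQueryAlg := fun n => PMF.pure (exactTree e n)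

/-- The exact algorithm is correct with probability `1`. [folklore] -/
theorem outputPr_exactAlg (e : ℕ → ℕ) (x : Fin n → Bool) :
    (exactAlg e).outputPr x (gapMajAnswer (e n) x) = 1 := by
  unfold exactAlg
  rw [outputPr_pure]
  simp [exactTree_computes e n x]

/-- The exact algorithm has a bounded gap. [folklore] -/
theorem exactAlg_isGapped (e : ℕ → ℕ) : (exactAlg e).IsGapped := by
  intro n x
  refine ⟨gapMajAnswer (e n) x, ?_⟩
  rw [outputPr_exactAlg]
  norm_num

/-- The exact algorithm uses `≤ n` queries. [folklore] -/
theorem exactAlg_queriesLe (e : ℕ → ℕ) : (exactAlg e).QueriesLe id := by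
  intro n T hT
  unfold exactAlg at hT
  rw [PMF.mem_support_pure_iff] at hT
  subst hT
  exact exactTree_depth_le e n

/-- The exact algorithm fails on no input. [folklore] -/
theorem not_failsOn_exactAlg (e : ℕ → ℕ) (x : Fin n → Bool) : ¬ (exactAlg e).FailsOn e x := by
  rintro ⟨-, h⟩
  rw [outputPr_exactAlg] at h
  norm_num at h

/-- **No family whatsoever refutes the exact algorithm.** [folklore] -/
theorem not_isGapMajRefuterAgainst_exactAlg (e : ℕ → ℕ) (C : CircuitFamily) :
    ¬ IsGapMajRefuterAgainst e (exactAlg e) C := by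
  intro h
  obtain ⟨k, hk⟩ := h.exists
  exact not_failsOn_exactAlg e _ hk

/-- If `n = o(e(n)²)` — i.e. `ε = o(n^{-1/2})` — the exact algorithm belongs to the refuted class.
[folklore] -/
theorem exactAlg_mem_of_isLittleO {e : ℕ → ℕ}
    (h : (fun n : ℕ => (n : ℝ)) =o[atTop] fun n => (e n : ℝ) ^ 2) :
    exactAlg e ∈ SubquadraticQueryAlgs e :=
  ⟨exactAlg_isGapped e, id, exactAlg_queriesLe e, by simpa using h⟩

/-- **Calibration of Thm. 1.6's hypothesis**: for `ε = o(n^{-1/2})` (`n = o(e(n)²)`) the typed —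
and hence the printed — constructive separation does not exist, with `AC⁰` or `NC¹` refuters alike,
since the class then contains the exact `n`-query algorithm. [folklore] -/
theorem not_hypothesis_of_isLittleO {e : ℕ → ℕ}
    (h : (fun n : ℕ => (n : ℝ)) =o[atTop] fun n => (e n : ℝ) ^ 2) :
    ¬ (∀ A ∈ SubquadraticQueryAlgs e, HasGapMajAC0Refuter e A) ∧
      ¬ (∀ A ∈ SubquadraticQueryAlgs e, HasGapMajNC1Refuter e A) := by
  constructor
  · intro H
    obtain ⟨c, C, -, hC⟩ := H _ (exactAlg_mem_of_isLittleO h)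
    exact not_isGapMajRefuterAgainst_exactAlg e C hC
  · intro H
    obtain ⟨c, C, -, hC⟩ := H _ (exactAlg_mem_of_isLittleO h)
    exact not_isGapMajRefuterAgainst_exactAlg e C hC

/-- **Consumer (census form of item 1).** [cite: ChenEtAl2022, Thm. 1.6 item 1] -/
theorem P_ne_NP_of_gapMajAC0Refuters (hT : thm16_item1) {e : ℕ → ℕ} (he : IsAdmissibleGap e)
    (h : ∀ A ∈ SubquadraticQueryAlgs e, HasGapMajAC0Refuter e A) :
    Classes.P ≠ Nondeterministic.NP :=
  hT e he h

/-- **Consumer (census form of item 2).** [cite: ChenEtAl2022, Thm. 1.6 item 2] -/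
theorem P_ne_PSPACE_of_gapMajNC1Refuters (hT : thm16_item2) {e : ℕ → ℕ} (he : IsAdmissibleGap e)
    (h : ∀ A ∈ SubquadraticQueryAlgs e, HasGapMajNC1Refuter e A) :
    Classes.P ≠ PSPACE :=
  hT e he h

end Literature.Computability.MetaComplexity.ChenJinSanthanamWilliams2022
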